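/-
Copyright (c) 2026 the pub-hodgecm-mathlib formalisation cell (harness21).  Prover seat hodgecm-mathlib-B-p04 (g47): LH4-plan (g6) price list (P1a-α) — the eigenvalue
clauses of ★ (D2-β) `TypeTwoEigenFieldPackage` with every `|2| = 1` step retired; 2026-09-02.
-/
import Literature.NumberTheory.LocalFields.WildQuadraticEisensteinFrame   -- ★ p851611 (this seat): the two-field wild frame currency (`j`, `hjv`), `v_skew_eq_one`
import HarnessLib

/-!
# The type-(2) eigenvalue `λ₁ = (jt + jy·α)∕2` over a ramified quadratic eigen-field at ANY residue characteristic: integrality and residual triviality by ROOT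
# arguments, norm one, `ι′λ₁ ≠ λ₁`, `|ju − λ₁| = exp(−n)`, `|λ₁ − ι′λ₁| = |y|²·|α|` (Rogawski 1990 Lemma 4.9.3; Serre I §6)

Topic `NumberTheory/Rogawski1990`; namespace `Literature.NumberTheory.Rogawski1990`.  THEOREMS ONLY (no definition, no instance, no notation, no named fact, no `sorry`); generic
two-field currency; kernel lane `--supports stmt-HodgeConjecture-24833`.  Cell `pub/hodgecm-mathlib` (D-0151), crux H413 = `stmt-HodgeConjecture-24833`; half A line LH4, M4 wall,
LH4-plan (g6) WORD #40 price list **(P1a)** «LOCAL wild eigen-data», HALF α (independent of the wild dictionary (P1b)).  ★ (D2-β) `TypeTwoEigenFieldPackage.exists_eigenField_package`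
proves the eigenvalue clauses of `λ₁ := (ι₁t + ι₁y·θ)·ι₁e₂` under `h2 : |2|_v = 1` at exactly two places — `λ₁ ∈ 𝒪` and `|λ₁ − 1| < 1` both via `|e₂| = 1` (and `|θ| < 1`) — and
states `|λ₁ − ι′λ₁| = exp(−(2N+1))` through the anti-fixed UNIFORMISER `θ`.  THIS FILE re-proves the clauses for a general skew square root `α` (`α² = j d₀`, `ι′α = −α`,
`s̃α = α`; `d₀` a uniformiser OR a unit `1 + w₀`) with NO hypothesis on `|2|`: integrality and residual triviality of `λ₁` by ROOT ARGUMENTS (`λ² = tλ − D` with `|t| ≤ 1`, `|D| = 1`;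
`(λ−1)² = (t−2)(λ−1) − χ(1)` with `|t − 2| < 1`, `|χ(1)| < 1`), and `|λ₁ − ι′λ₁| = |y|²·|α|` (`= exp(−(2N+1))` tame ∕ wild odd-order, `= exp(−2N)` at a wild UNIT-discriminant
row — the «`L` even» of B-p04's memo `MEMO-M4-wild-parity.v1` §1).  ONE new binder versus ★: **`hχ1 : |1 − t + D| < 1`** (`= |χ_g(1)|_v`, residual unipotence; at `|2| = 1` it
follows from `4χ(1) = (t−2)² − y²d₀`, at `v ∣ 2` it does not).  HALF β (the `∃ α s̃ ι′` package with the dictionaries (rE)(nK)(nE)) waits for the wild dictionary (P1b).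
HONEST LABEL: HC_CM is proved only modulo the 7 printed citations (2 remaining named inputs: hLiu418 = stmt-HodgeConjecture-24832, h413 = stmt-HodgeConjecture-24833) until rung 0
closes; count-neutral (pays no organ, opens no road).

CURRENCY.  `j : E →+* K` (`ι₁ = toPlace v w`), `hjv : |j x| = |x|²` (ramified, `e = 2`); `s : E →+* E` (CM conjugation of `E = L_w`), `s̃ = s' : K →+* K` over `s` fixing `α`, isometric;
`ι′ : K →+* K` over `id` with `ι′α = −α`, isometric; eigen-data `u t D y e₂ : E` with `e₂·2 = 1`, `4D = t² − y²d₀`, `D·sD = 1`, `s t = t·sD`, `s y = −y·sD` (★ (D1)),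
`|χ(u)| = |u² − tu + D| = exp(−n)`, `|y| = exp(−N)`, `|t − 2| < 1`, `|1 − t + D| < 1`.  `λ₁ := (j t + j y·α)·j e₂`, `λ₂ := (j t − j y·α)·j e₂ = ι′λ₁`.

## References
* [Rogawski1990] J. D. Rogawski, *Automorphic Representations of Unitary Groups in Three Variables* (1990): §4.9 Lemma 4.9.3 p. 56, Prop. 4.9.1 (b) p. 55.
* [SerreLocalFields1979] J.-P. Serre, *Local Fields*, GTM 67 (1979): Ch. I §6 Prop. 17–18 (integral elements; Eisenstein equations), Ch. II §2.
* [Jacobowitz1962] R. Jacobowitz, *Hermitian forms over local fields*, Amer. J. Math. 84 (1962): §5, §§9–11.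
-/

set_option autoImplicit false

noncomputable section

open scoped Valued WithZero
open WithZero

namespace Literature.NumberTheory.Rogawski1990

/-! ## §1 Root arguments over a valued field: integrality and residual triviality of a root of `X² − TX + Δ` -/

section Roots

variable {K : Type*} [Field K] [Valued K ℤᵐ⁰]

/-- **A root of `X² − TX + Δ` with `|T| ≤ 1`, `|Δ| ≤ 1` is integral** (`|λ| > 1` would make `|λ²| > |Tλ − Δ|`). [cite: SerreLocalFields1979, Ch. I §6 Prop. 17] -/
theorem v_le_one_of_root_quadratic {lam T Δ : K} (h : lam * lam - T * lam + Δ = 0) (hT : Valued.v T ≤ 1) (hΔ : Valued.v Δ ≤ 1) : Valued.v lam ≤ 1 := by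
  by_contra hgt
  rw [not_le] at hgt
  have h0 : lam ≠ 0 := fun h0 => by rw [h0, map_zero] at hgt; exact not_lt_zero hgt
  have hv0 : Valued.v lam ≠ 0 := (Valuation.ne_zero_iff _).2 h0
  have hsq : lam * lam = T * lam - Δ := by linear_combination h
  have h1 : Valued.v (T * lam) < Valued.v (lam * lam) := by
    rw [map_mul, map_mul]
    calc Valued.v T * Valued.v lam ≤ 1 * Valued.v lam := mul_le_mul_left hT _
      _ < Valued.v lam * Valued.v lam := by rw [one_mul]; exact lt_mul_of_one_lt_left (zero_lt_iff.2 hv0) hgt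
  have h2 : Valued.v Δ < Valued.v (lam * lam) := by
    rw [map_mul]
    exact hΔ.trans_lt (one_lt_mul_of_lt_of_le hgt hgt.le)
  have h3 : Valued.v (T * lam - Δ) < Valued.v (lam * lam) := (Valuation.map_sub _ _ _).trans_lt (max_lt h1 h2)
  rw [← hsq] at h3
  exact lt_irrefl _ h3

/-- **A root of `X² − TX + Δ` with `|T| < 1`, `|Δ| < 1` lies in `𝔪`**: `|λ| < 1` (`|λ| ≥ 1` would make `|λ²| > |Tλ − Δ|`). [cite: SerreLocalFields1979, Ch. I §6 Prop. 17] -/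
theorem v_lt_one_of_root_quadratic {lam T Δ : K} (h : lam * lam - T * lam + Δ = 0) (hT : Valued.v T < 1) (hΔ : Valued.v Δ < 1) : Valued.v lam < 1 := by
  by_contra hge
  rw [not_lt] at hge
  have h0 : lam ≠ 0 := fun h0 => by rw [h0, map_zero] at hge; exact not_le.2 zero_lt_one hge
  have hv0 : Valued.v lam ≠ 0 := (Valuation.ne_zero_iff _).2 h0
  have hsq : lam * lam = T * lam - Δ := by linear_combination h
  have h1 : Valued.v (T * lam) < Valued.v (lam * lam) := by
    rw [map_mul, map_mul]
    calc Valued.v T * Valued.v lam < 1 * Valued.v lam := mul_lt_mul_of_pos_right hT (zero_lt_iff.2 hv0)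
      _ ≤ Valued.v lam * Valued.v lam := by rw [one_mul]; exact le_mul_of_one_le_left zero_le hge
  have h2 : Valued.v Δ < Valued.v (lam * lam) := by
    rw [map_mul]
    exact hΔ.trans_le (one_le_mul hge hge)
  have h3 : Valued.v (T * lam - Δ) < Valued.v (lam * lam) := (Valuation.map_sub _ _ _).trans_lt (max_lt h1 h2)
  rw [← hsq] at h3
  exact lt_irrefl _ h3

/-- **`χ(1) = χ(u) + (1 − u)(1 + u − t)`** for `χ = X² − tX + D` (the whole dyadic content of «`|λ₁ − 1| < 1`»: residual unipotence `|χ(1)| < 1` from a depth-zero norm-one root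
`u`). [cite: Rogawski1990, §4.9 Lemma 4.9.3 p. 56] -/
theorem charpoly_one_eq_charpoly_add {R : Type*} [CommRing R] (u t D : R) : 1 - t + D = (u * u - t * u + D) + (1 - u) * (1 + u - t) := by ring

/-- **`|1 − t + D| < 1` from depth zero**: `|u − 1| < 1`, `|t − 2| < 1` and `|χ(u)| < 1` give `|χ(1)| < 1` (`1 + u − t = (u − 1) − (t − 2)`). [cite: Rogawski1990, §4.9 Lemma 4.9.3 p. 56] -/
theorem v_charpoly_one_lt_one {u t D : K} (hu1 : Valued.v (u - 1) < 1) (ht2 : Valued.v (t - 2) < 1) (hχu : Valued.v (u * u - t * u + D) < 1) :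
    Valued.v (1 - t + D) < 1 := by
  rw [charpoly_one_eq_charpoly_add u t D]
  refine Valuation.map_add_lt _ hχu ?_
  rw [map_mul, show (1 : K) - u = -(u - 1) by ring, Valuation.map_neg, show 1 + u - t = (u - 1) - (t - 2) by ring]
  calc Valued.v (u - 1) * Valued.v (u - 1 - (t - 2)) ≤ Valued.v (u - 1) * 1 :=
        mul_le_mul_right ((Valuation.map_sub _ _ _).trans (max_le hu1.le ht2.le)) _
    _ < 1 := by rw [mul_one]; exact hu1

end Roots

/-! ## §2 The eigenvalue clauses in the two-field frame (no `|2|` hypothesis) -/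

section Eigenvalue

variable {E K : Type*} [Field E] [Field K] [Valued E ℤᵐ⁰] [Valued K ℤᵐ⁰]
  (j : E →+* K) (s : E →+* E) (s' ι' : K →+* K)

/-- **THE WILD∕TAME-UNIFORM EIGENVALUE CLAUSES.**  `λ₁ := (jt + jy·α)·je₂` for a skew square root `α` (`α² = j d₀`, `s̃α = α`, `ι′α = −α`, `α ≠ 0`) and (D1)-type eigen-data
(`e₂·2 = 1`, `4D = t² − y²d₀`, `D·sD = 1`, `s t = t·sD`, `s y = −y·sD`, `|u² − tu + D| = exp(−n)`, `|t − 2| < 1`, `|1 − t + D| < 1`, `y ≠ 0`): then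
`λ₁² − jt·λ₁ + jD = 0`, `|λ₁| ≤ 1`, `|λ₁ − 1| < 1`, `λ₁·s̃λ₁ = 1`, `ι′λ₁ = (jt − jy·α)·je₂ ≠ λ₁`, `|ju − λ₁| = exp(−n)`, and `λ₁ − ι′λ₁ = jy·α` (so `|λ₁ − ι′λ₁| = |y|²·|α|`) —
the clause block of ★ (D2-β) with the two `|e₂| = 1` steps replaced by the root arguments of §1 and `θ` by `α`.  Isometry inputs: `|j x| = |x|²`, `|ι′ z| = |z|`.
[cite: Rogawski1990, §4.9 Lemma 4.9.3 p. 56] [cite: SerreLocalFields1979, Ch. I §6 Prop. 17–18] [cite: Jacobowitz1962, §§9–11] -/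
theorem eigenvalue_clauses_of_skew_sqrt (hjv : ∀ x, Valued.v (j x) = Valued.v x ^ 2) (hs'j : ∀ x, s' (j x) = j (s x)) (hι'j : ∀ x, ι' (j x) = j x)
    (hι'v : ∀ z, Valued.v (ι' z) = Valued.v z) (hsv : ∀ x, Valued.v (s x) = Valued.v x)
    {α : K} {d₀ : E} (hα : α ^ 2 = j d₀) (hα0 : α ≠ 0) (hs'α : s' α = α) (hι'α : ι' α = -α)
    {u t D y e₂ : E} (h2e : e₂ * 2 = 1) (hD : 4 * D = t * t - y * y * d₀) (hσD : D * s D = 1) (hσt : s t = t * s D) (hσy : s y = -(y * s D))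
    {n : ℕ} (hn : Valued.v (u * u - t * u + D) = exp (-(n : ℤ))) (hy0 : y ≠ 0) (ht2 : Valued.v (t - 2) < 1) (hχ1 : Valued.v (1 - t + D) < 1) :
    ((j t + j y * α) * j e₂) ^ 2 - j t * ((j t + j y * α) * j e₂) + j D = 0 ∧
      Valued.v ((j t + j y * α) * j e₂) ≤ 1 ∧
      Valued.v ((j t + j y * α) * j e₂ - 1) < 1 ∧
      (j t + j y * α) * j e₂ * s' ((j t + j y * α) * j e₂) = 1 ∧
      ι' ((j t + j y * α) * j e₂) = (j t - j y * α) * j e₂ ∧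
      ι' ((j t + j y * α) * j e₂) ≠ (j t + j y * α) * j e₂ ∧
      Valued.v (j u - (j t + j y * α) * j e₂) = exp (-(n : ℤ)) ∧
      (j t + j y * α) * j e₂ - ι' ((j t + j y * α) * j e₂) = j y * α := by
  have hjinj : Function.Injective j := j.injective
  -- `2 ≠ 0`, `s e₂ = e₂`
  have h20 : (2 : E) ≠ 0 := fun h0 => by
    have := h2e; rw [h0, mul_zero] at this; exact zero_ne_one this
  have hse₂ : s e₂ = e₂ := by
    have h1 : s e₂ * 2 = 1 := by have := congrArg s h2e; rwa [map_mul, map_ofNat, map_one] at this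
    exact mul_right_cancel₀ h20 (h1.trans h2e.symm)
  have h2e' : j e₂ * 2 = 1 := by rw [← map_ofNat j 2, ← map_mul, h2e, map_one]
  have hD' : 4 * j D = j t * j t - j y * j y * α ^ 2 := by
    rw [hα, ← map_mul, ← map_mul, ← map_mul, ← map_sub, ← map_ofNat j 4, ← map_mul, hD]
  -- valuations of the data
  have hvt : Valued.v t ≤ 1 := by
    have h := Valuation.map_add Valued.v (t - 2) 2
    rw [sub_add_cancel] at h
    refine h.trans (max_le ht2.le ?_)
    have h' := Valuation.map_add Valued.v (1 : E) 1
    rw [one_add_one_eq_two, Valuation.map_one, max_self] at h'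
    exact h'
  have hvD : Valued.v D = 1 := by
    have h := congrArg Valued.v hσD
    rw [map_mul, hsv, map_one] at h
    rcases lt_trichotomy (Valued.v D) 1 with hlt | heq | hgt
    · exact absurd h (ne_of_lt (by calc Valued.v D * Valued.v D < 1 * 1 := mul_lt_mul'' hlt hlt zero_le zero_le
        _ = 1 := one_mul 1))
    · exact heq
    · exact absurd h (ne_of_gt (by calc (1 : ℤᵐ⁰) = 1 * 1 := (one_mul 1).symm
        _ < Valued.v D * Valued.v D := mul_lt_mul'' hgt hgt zero_le zero_le))
  -- the conjugates
  have hι'lam : ι' ((j t + j y * α) * j e₂) = (j t - j y * α) * j e₂ := by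
    rw [map_mul, map_add, map_mul, hι'j, hι'j, hι'j, hι'α]; ring
  have hs'lam : s' ((j t + j y * α) * j e₂) = j (s D) * ((j t - j y * α) * j e₂) := by
    rw [map_mul, map_add, map_mul, hs'j, hs'j, hs'j, hs'α, hσt, hσy, hse₂, map_mul, map_neg, map_mul]; ring
  have hdiff : (j t + j y * α) * j e₂ - (j t - j y * α) * j e₂ = j y * α := by linear_combination (j y * α) * h2e'
  -- elementary symmetric functions
  have hsum : (j t + j y * α) * j e₂ + (j t - j y * α) * j e₂ = j t := by linear_combination (j t) * h2e'
  have hprd : (j t + j y * α) * j e₂ * ((j t - j y * α) * j e₂) = j D := by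
    linear_combination (-(j e₂ ^ 2)) * hD' + (j D * (2 * j e₂ + 1)) * h2e'
  have hquad : ((j t + j y * α) * j e₂) ^ 2 - j t * ((j t + j y * α) * j e₂) + j D = 0 := by
    linear_combination ((j t + j y * α) * j e₂) * hsum - hprd
  have hquad' : (j t + j y * α) * j e₂ * ((j t + j y * α) * j e₂) - j t * ((j t + j y * α) * j e₂) + j D = 0 := by
    rw [← sq]; exact hquad
  have hprod : (j u - (j t + j y * α) * j e₂) * (j u - (j t - j y * α) * j e₂) = j (u * u - t * u + D) := by
    rw [map_add, map_sub, map_mul, map_mul]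
    linear_combination (-(j u)) * hsum + hprd
  have hnorm1 : (j t + j y * α) * j e₂ * s' ((j t + j y * α) * j e₂) = 1 := by
    have hσD' : j D * j (s D) = 1 := by rw [← map_mul, hσD, map_one]
    rw [hs'lam]
    linear_combination (j (s D)) * hprd + hσD'
  refine ⟨hquad, ?_, ?_, hnorm1, hι'lam, ?_, ?_, by rw [hι'lam, hdiff]⟩
  · -- `|λ₁| ≤ 1` by the root argument
    refine v_le_one_of_root_quadratic hquad' ?_ ?_
    · rw [hjv]; exact pow_le_one₀ zero_le hvt
    · rw [hjv, hvD, one_pow]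
  · -- `|λ₁ − 1| < 1`: `(λ−1)² − (jt−2)(λ−1) + j(1 − t + D) = 0`
    have hμ : ((j t + j y * α) * j e₂ - 1) * ((j t + j y * α) * j e₂ - 1) - (j t - 2) * ((j t + j y * α) * j e₂ - 1) + j (1 - t + D) = 0 := by
      rw [map_add, map_sub, map_one]
      linear_combination hquad'
    refine v_lt_one_of_root_quadratic hμ ?_ ?_
    · rw [show j t - 2 = j (t - 2) by rw [map_sub, map_ofNat], hjv]; exact pow_lt_one₀ zero_le ht2 two_ne_zero
    · rw [hjv]; exact pow_lt_one₀ zero_le hχ1 two_ne_zero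
  · -- `ι′λ₁ ≠ λ₁`
    rw [hι'lam]
    intro h
    have h0 : j y * α = 0 := by rw [← hdiff, h, sub_self]
    rcases mul_eq_zero.1 h0 with h1 | h1
    · exact hy0 ((map_eq_zero_iff _ hjinj).1 h1)
    · exact hα0 h1
  · -- `|ju − λ₁| = exp(−n)`
    have hsq : Valued.v (j u - (j t + j y * α) * j e₂) ^ 2 = exp (-(n : ℤ)) ^ 2 := by
      have hconj : ι' (j u - (j t + j y * α) * j e₂) = j u - (j t - j y * α) * j e₂ := by rw [map_sub, hι'j, hι'lam]
      rw [sq, ← exp_nsmul]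
      nth_rw 2 [← hι'v]
      rw [hconj, ← map_mul, hprod, hjv, hn, ← exp_nsmul]
    have h0 : Valued.v (j u - (j t + j y * α) * j e₂) ≠ 0 := by
      intro h0; rw [h0, zero_pow two_ne_zero, eq_comm] at hsq; exact (pow_ne_zero 2 exp_ne_zero) hsq
    have hx := exp_log h0
    rw [← hx, ← exp_nsmul, ← exp_nsmul, exp_inj, nsmul_eq_mul, nsmul_eq_mul] at hsq
    rw [← hx]
    congr 1
    push_cast at hsq
    omega

/-- **`|λ₁ − ι′λ₁| = |y|²·|α|`**: `= exp(−(2N+1))` when `α = θ` is the anti-fixed uniformiser (tame ∕ wild odd-order rows, ★ (D2-β)), `= exp(−2N)` — EVEN — when `α` is the skew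
UNIT of a wild unit-discriminant row (`α² = j(1 + w₀)`, `|w₀| < 1`). [cite: Rogawski1990, §4.9 Lemma 4.9.3 p. 56] [cite: Jacobowitz1962, §§9–11] -/
theorem v_eigenvalue_sub_map_of_skew_unit (hjv : ∀ x, Valued.v (j x) = Valued.v x ^ 2) (hι'j : ∀ x, ι' (j x) = j x)
    {α : K} {w₀ : E} (hα : α ^ 2 = j (1 + w₀)) (hw₀ : Valued.v w₀ < 1) (hι'α : ι' α = -α)
    {t y e₂ : E} (h2e : e₂ * 2 = 1) {N : ℕ} (hN : Valued.v y = exp (-(N : ℤ))) :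
    Valued.v ((j t + j y * α) * j e₂ - ι' ((j t + j y * α) * j e₂)) = exp (-(2 * (N : ℤ))) := by
  have h2e' : j e₂ * 2 = 1 := by rw [← map_ofNat j 2, ← map_mul, h2e, map_one]
  have hι'lam : ι' ((j t + j y * α) * j e₂) = (j t - j y * α) * j e₂ := by
    rw [map_mul, map_add, map_mul, hι'j, hι'j, hι'j, hι'α]; ring
  have hdiff : (j t + j y * α) * j e₂ - (j t - j y * α) * j e₂ = j y * α := by linear_combination (j y * α) * h2e'
  have hvα : Valued.v α = 1 := by
    refine Literature.NumberTheory.LocalFields.v_skew_eq_one (w := j w₀) (by rw [← sq, hα, map_add, map_one]) ?_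
    rw [hjv]; exact pow_lt_one₀ zero_le hw₀ two_ne_zero
  rw [hι'lam, hdiff, map_mul, hjv, hN, hvα, mul_one, ← exp_nsmul, nsmul_eq_mul]
  congr 1; push_cast; ring

end Eigenvalue

end Literature.NumberTheory.Rogawski1990

end
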